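/-
Copyright (c) 2026. All rights reserved.
Released under Apache 2.0 license as described in the file LICENSE.
Authors: abc-iut cell, prover seat abc-iut-L4-t15 (wave 2).
-/
import Literature.AnabelianGeometry.AbsoluteAnabelian.DiagramsOfCategories

/-!
# Telecores: the boundary set of a telecore family ([AbsTopIII] Def. 3.5 (iv) (b), path combinatorics)

S. Mochizuki, *Topics in Absolute Anabelian Geometry III*, Def. 3.5 (iv) p. 76 (manuscript
`paper:url-5493eb38cbb7`, bib key `MochizukiAbsTopIII2015`): the family of homotopies `𝒥` of a telecore has
boundary set "equal to the subset of pairs `([γ₃]∘[γ₁], [γ₃]∘[γ₂])` where `([γ₁],[γ₂])` is a co-verticial pair of paths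
on `Γ⃗_𝒯` with terminal vertex `v_𝒮` and `[γ₃]` is a path on `Γ⃗_𝒯` with initial vertex `v_𝒮`".

This file is the pure PATH COMBINATORICS of that boundary set on the extended graphs of abc-iut-L4-t2's
`DiagramsOfCategories.lean` (`ExtShape`, vertices `ExtVertex V`): the decomposition `lastSplit` of a path at its LAST
visit of the observation vertex `v_𝒮` (structural recursion, decidable because `v_𝒮` is a constructor), its algebra
(`eq_comp_of_lastSplit`, `lastSplit_comp`), the printed relation `TeleRel` and its characterisation "both paths visit
`v_𝒮` and agree after their last visits" (`teleRel_iff`), its SATURATION (`teleRel_isSaturated`, §0 (a)(c)(d)(e)),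
and the canonical decompositions `splitLeft` / `splitRight` of a boundary pair with their common tail (`splitLeft_snd`).
Used by `DiagramTelecoreFamilies.lean` (the homotopies).  Elementary; plumbing `def`s are `[folklore]`, the statements cite Def. 3.5 (iv) whose bookkeeping they are.
Nothing here bears on [IUTchIII] Cor. 3.12.
-/

set_option autoImplicit false

namespace Literature.AnabelianGeometry.AbsoluteAnabelian

open _root_.CategoryTheory _root_.Quiver

universe v u w

/-! ## Path combinatorics: the last visit of the observation vertex -/

namespace ExtShape

variable {V : Type w} [Quiver.{v} V] (X : ExtShape.{v} V)

/-- split of the empty path: it visits `v_𝒮` iff it sits at `v_𝒮`. [folklore] -/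
def nilSplit : (a : X.Vertex) → Option (Path a X.obs × Path X.obs a)
  | ExtVertex.obs => some (Path.nil, Path.nil)
  | ExtVertex.base _ => none

/-- split of a path extended by one edge, from the split of the path: an edge INTO `v_𝒮` restarts the tail.
[folklore] -/
def consSplit {a c : X.Vertex} (s : Option (Path a X.obs × Path X.obs c)) (p : Path a c) :
    (b : X.Vertex) → (c ⟶ b) → Option (Path a X.obs × Path X.obs b)
  | ExtVertex.obs, e => some (p.cons e, Path.nil)
  | ExtVertex.base _, e => s.map fun s => (s.1, s.2.cons e)

/-- The decomposition `γ = γ₃ ∘ γ₁` of a path of the extended graph at its LAST visit of the observation vertex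
`v_𝒮` (`γ₁ : a ⟶ v_𝒮`, `γ₃ : v_𝒮 ⟶ b` not passing through `v_𝒮` again), if the path visits `v_𝒮` at all. [folklore] -/
def lastSplit {a : X.Vertex} : {b : X.Vertex} → Path a b → Option (Path a X.obs × Path X.obs b)
  | _, Path.nil => X.nilSplit a
  | b, Path.cons p e => X.consSplit (lastSplit p) p b e

/-- The empty path at `v_𝒮`. [cite: MochizukiAbsTopIII2015, Definition 3.5 (iv) p.76] -/
@[simp] theorem lastSplit_nil_obs : X.lastSplit (Path.nil : Path X.obs X.obs) = some (Path.nil, Path.nil) := rfl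

/-- The empty path at an old vertex does not visit `v_𝒮`. [cite: MochizukiAbsTopIII2015, Definition 3.5 (iv) p.76] -/
@[simp] theorem lastSplit_nil_base (x : V) : X.lastSplit (Path.nil : Path (X.base x) (X.base x)) = none := rfl

/-- The split of a path extended by an edge into `v_𝒮`. [cite: MochizukiAbsTopIII2015, Definition 3.5 (iv) p.76] -/
@[simp] theorem lastSplit_cons_obs {a c : X.Vertex} (p : Path a c) (e : c ⟶ X.obs) :
    X.lastSplit (p.cons e) = some (p.cons e, Path.nil) := rfl

/-- The split of a path extended by an edge into an old vertex. [cite: MochizukiAbsTopIII2015, Definition 3.5 (iv) p.76] -/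
@[simp] theorem lastSplit_cons_base {a c : X.Vertex} (p : Path a c) (x : V) (e : c ⟶ X.base x) :
    X.lastSplit (p.cons e) = (X.lastSplit p).map fun s => (s.1, s.2.cons e) := rfl

/-- A path ending at `v_𝒮` splits trivially. [cite: MochizukiAbsTopIII2015, Definition 3.5 (iv) p.76] -/
theorem lastSplit_of_target_obs {a : X.Vertex} (p : Path a X.obs) : X.lastSplit p = some (p, Path.nil) := by
  cases p with
  | nil => rfl
  | cons p e => rfl

/-- A split recomposes to the path. [cite: MochizukiAbsTopIII2015, Definition 3.5 (iv) p.76] -/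
theorem eq_comp_of_lastSplit {a : X.Vertex} :
    ∀ {b : X.Vertex} (p : Path a b) {s : Path a X.obs × Path X.obs b}, X.lastSplit p = some s → p = s.1.comp s.2
  | _, Path.nil, s, h => by
    revert s
    cases a with
    | obs => intro s h; cases h; rfl
    | base x => intro s h; cases h
  | b, Path.cons p e, s, h => by
    revert e s
    cases b with
    | obs => intro e s h; cases h; rfl
    | base x =>
      intro e s h
      obtain ⟨s', hs', rfl⟩ := Option.map_eq_some_iff.mp h
      change p.cons e = (s'.1.comp s'.2).cons e
      rw [← eq_comp_of_lastSplit p hs']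

/-- A path starting at `v_𝒮` visits `v_𝒮`. [cite: MochizukiAbsTopIII2015, Definition 3.5 (iv) p.76] -/
theorem exists_lastSplit_of_source_obs : ∀ {b : X.Vertex} (r : Path X.obs b), ∃ s, X.lastSplit r = some s
  | _, Path.nil => ⟨(Path.nil, Path.nil), rfl⟩
  | b, Path.cons r e => by
    revert e
    cases b with
    | obs => intro e; exact ⟨_, rfl⟩
    | base x =>
      intro e
      obtain ⟨s, hs⟩ := exists_lastSplit_of_source_obs r
      exact ⟨(s.1, s.2.cons e), by change (X.lastSplit r).map _ = _; rw [hs]; rfl⟩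

/-- The split of `r ∘ γ₁` (`γ₁ : a ⟶ v_𝒮`, `r : v_𝒮 ⟶ b`) is the split of `r` with `γ₁` prepended: it depends on `r`
only through ITS last visit of `v_𝒮`. [cite: MochizukiAbsTopIII2015, Definition 3.5 (iv) p.76] -/
theorem lastSplit_comp {a : X.Vertex} (p : Path a X.obs) :
    ∀ {b : X.Vertex} (r : Path X.obs b), X.lastSplit (p.comp r) = (X.lastSplit r).map fun s => (p.comp s.1, s.2)
  | _, Path.nil => by rw [Path.comp_nil, lastSplit_of_target_obs]; rfl
  | b, Path.cons r e => by
    revert e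
    cases b with
    | obs => intro e; rfl
    | base x =>
      intro e
      change (X.lastSplit (p.comp r)).map _ = ((X.lastSplit r).map _).map _
      rw [lastSplit_comp p r, Option.map_map, Option.map_map]
      rfl

/-- **The printed boundary relation of a telecore** (Def 3.5 (iv) (b)): `([γ₃]∘[γ₁], [γ₃]∘[γ₂])` for co-verticial
`[γ₁], [γ₂]` ending at `v_𝒮` and `[γ₃]` starting at `v_𝒮`. [cite: MochizukiAbsTopIII2015, Definition 3.5 (iv) p.76] -/
def TeleRel ⦃a b : X.Vertex⦄ (p q : Path a b) : Prop :=
  ∃ (p₁ q₁ : Path a X.obs) (r : Path X.obs b), p = p₁.comp r ∧ q = q₁.comp r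

/-- The boundary relation in terms of last splits: both paths visit `v_𝒮` and agree after their last visits.
[cite: MochizukiAbsTopIII2015, Definition 3.5 (iv) p.76] -/
theorem teleRel_iff {a b : X.Vertex} (p q : Path a b) :
    X.TeleRel p q ↔ ∃ sp sq, X.lastSplit p = some sp ∧ X.lastSplit q = some sq ∧ sp.2 = sq.2 := by
  constructor
  · rintro ⟨p₁, q₁, r, rfl, rfl⟩
    obtain ⟨s, hs⟩ := X.exists_lastSplit_of_source_obs r
    refine ⟨(p₁.comp s.1, s.2), (q₁.comp s.1, s.2), ?_, ?_, rfl⟩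
    · rw [lastSplit_comp, hs]; rfl
    · rw [lastSplit_comp, hs]; rfl
  · rintro ⟨sp, sq, hp, hq, h⟩
    refine ⟨sp.1, sq.1, sp.2, X.eq_comp_of_lastSplit p hp, ?_⟩
    rw [h]
    exact X.eq_comp_of_lastSplit q hq

/-- The boundary relation is reflexive on the paths that visit `v_𝒮`. [cite: MochizukiAbsTopIII2015, Definition 3.5 (iv) p.76] -/
theorem teleRel_refl_of_lastSplit {a b : X.Vertex} {p : Path a b} {s} (h : X.lastSplit p = some s) :
    X.TeleRel p p :=
  (X.teleRel_iff p p).mpr ⟨s, s, h, h, rfl⟩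

/-- **The boundary relation of a telecore is saturated** (Def 3.5 (ii) (a): §0 conditions (a), (c), (d), (e)).
[cite: MochizukiAbsTopIII2015, Definition 3.5 (iv) p.76] -/
theorem teleRel_isSaturated : IsSaturated X.TeleRel where
  refl_left _ _ _ _ h := by
    obtain ⟨p₁, -, r, hp, -⟩ := h
    exact ⟨p₁, p₁, r, hp, hp⟩
  refl_right _ _ _ _ h := by
    obtain ⟨-, q₁, r, -, hq⟩ := h
    exact ⟨q₁, q₁, r, hq, hq⟩
  trans _ _ p q s h₁ h₂ := by
    obtain ⟨sp, sq, hp, hq, e₁⟩ := (X.teleRel_iff p q).mp h₁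
    obtain ⟨sq', ss, hq', hs, e₂⟩ := (X.teleRel_iff q s).mp h₂
    obtain rfl : sq = sq' := Option.some.inj (hq.symm.trans hq')
    exact (X.teleRel_iff p s).mpr ⟨sp, ss, hp, hs, e₁.trans e₂⟩
  precomp _ _ _ _ _ h r := by
    obtain ⟨p₁, q₁, r', hp, hq⟩ := h
    exact ⟨r.comp p₁, r.comp q₁, r', by rw [hp, Path.comp_assoc], by rw [hq, Path.comp_assoc]⟩
  postcomp _ _ _ _ _ h r := by
    obtain ⟨p₁, q₁, r', hp, hq⟩ := h
    exact ⟨p₁, q₁, r'.comp r, by rw [hp, Path.comp_assoc], by rw [hq, Path.comp_assoc]⟩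

/-- The canonical decomposition of the LEFT path of a boundary pair (at its last visit of `v_𝒮`). [folklore] -/
noncomputable def splitLeft {a b : X.Vertex} {p q : Path a b} (h : X.TeleRel p q) : Path a X.obs × Path X.obs b :=
  (X.lastSplit p).get (by
    obtain ⟨sp, -, hp, -, -⟩ := (X.teleRel_iff p q).mp h
    simp [hp])

/-- The canonical decomposition of the RIGHT path of a boundary pair. [folklore] -/
noncomputable def splitRight {a b : X.Vertex} {p q : Path a b} (h : X.TeleRel p q) : Path a X.obs × Path X.obs b :=
  (X.lastSplit q).get (by
    obtain ⟨-, sq, -, hq, -⟩ := (X.teleRel_iff p q).mp h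
    simp [hq])

/-- `splitLeft` is the last split. [cite: MochizukiAbsTopIII2015, Definition 3.5 (iv) p.76] -/
theorem lastSplit_eq_splitLeft {a b : X.Vertex} {p q : Path a b} (h : X.TeleRel p q) :
    X.lastSplit p = some (X.splitLeft h) :=
  (Option.some_get _).symm

/-- `splitRight` is the last split. [cite: MochizukiAbsTopIII2015, Definition 3.5 (iv) p.76] -/
theorem lastSplit_eq_splitRight {a b : X.Vertex} {p q : Path a b} (h : X.TeleRel p q) :
    X.lastSplit q = some (X.splitRight h) :=
  (Option.some_get _).symm

/-- The left path recomposes from its canonical decomposition. [cite: MochizukiAbsTopIII2015, Definition 3.5 (iv) p.76] -/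
theorem eq_comp_splitLeft {a b : X.Vertex} {p q : Path a b} (h : X.TeleRel p q) :
    p = (X.splitLeft h).1.comp (X.splitLeft h).2 :=
  X.eq_comp_of_lastSplit p (X.lastSplit_eq_splitLeft h)

/-- The two canonical decompositions of a boundary pair share their tail `γ₃`. [cite: MochizukiAbsTopIII2015, Definition 3.5 (iv) p.76] -/
theorem splitLeft_snd {a b : X.Vertex} {p q : Path a b} (h : X.TeleRel p q) :
    (X.splitLeft h).2 = (X.splitRight h).2 := by
  obtain ⟨sp, sq, hp, hq, e⟩ := (X.teleRel_iff p q).mp h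
  obtain rfl : sp = X.splitLeft h := Option.some.inj (hp.symm.trans (X.lastSplit_eq_splitLeft h))
  obtain rfl : sq = X.splitRight h := Option.some.inj (hq.symm.trans (X.lastSplit_eq_splitRight h))
  exact e

/-- The right path recomposes from its canonical head and the COMMON tail. [cite: MochizukiAbsTopIII2015, Definition 3.5 (iv) p.76] -/
theorem eq_comp_splitRight {a b : X.Vertex} {p q : Path a b} (h : X.TeleRel p q) :
    q = (X.splitRight h).1.comp (X.splitLeft h).2 := by
  rw [X.splitLeft_snd h]
  exact X.eq_comp_of_lastSplit q (X.lastSplit_eq_splitRight h)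

end ExtShape

end Literature.AnabelianGeometry.AbsoluteAnabelian
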